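import Literature.NumberTheory.Sieve.ParityWave0

/-!
# Bombieri–Vinogradov: the character-sum layer and Vaughan's mean value theorem

Support file for the discharge programme of the named fact `Literature.NumberTheory.Sieve.bombieri_vinogradov`
(parity.S27, `Literature/NumberTheory/Sieve/ParityWave0.lean`; Bombieri, Mathematika 12 (1965),
Theorem 4). The classical proof (Vaughan, Acta Arith. 37 (1980); Davenport, *Multiplicative Number
Theory*, ch. 28; Cojocaru–Murty, *An Introduction to Sieve Methods*, §9.2) has two inputs:

* **Vaughan's basic mean value theorem** for the twisted Chebyshev functions
  `ψ(y, χ) = ∑_{n ≤ y} Λ(n) χ(n)` summed over primitive characters — vendored here as the named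
  fact `vaughan_meanValue` (Vaughan 1980, Theorem 1; restated verbatim in Bordellès, *Arithmetic
  Tales*, Thm 4.51);
* the **Siegel–Walfisz theorem**, already vendored as `Literature.NumberTheory.Sieve.siegel_walfisz` (parity.S28).

The deduction `vaughan_meanValue → siegel_walfisz → bombieri_vinogradov` (orthogonality, reduction
to primitive characters, partial summation) is elementary and is the subject of the sibling file
`BombieriVinogradovReduction.lean`.

## Contents

* `chebyshevPsiChar χ x = ψ(x, χ) = ∑_{0 ≤ n ≤ x} χ(n) Λ(n)` (complex valued; the `n = 0` term
  vanishes since `Λ 0 = 0`), the character twist of `Literature.NumberTheory.Sieve.ParityWave0.chebyshevPsiMod`; the summand is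
  written `χ n * Λ n` exactly as in Mathlib's `ArithmeticFunction.vonMangoldt.residueClass_apply`.
* `chebyshevPsiCharSup χ Y = max_{y ≤ Y} |ψ(y, χ)|`, realised junk-free as the `Finset.sup'` of
  `‖ψ(N, χ)‖` over the integers `0 ≤ N ≤ ⌊Y⌋₊` (`ψ(y, χ)` only depends on `⌊y⌋₊`, see
  `chebyshevPsiChar_eq_floor`, and vanishes for `y < 1`).
* API: `chebyshevPsiChar_eq_floor`, `norm_chebyshevPsiChar_le_psi` (`|ψ(y, χ)| ≤ ψ(y)`),
  `norm_chebyshevPsiChar_le_sup`, `chebyshevPsiCharSup_nonneg`, `chebyshevPsiCharSup_le`.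
* The named fact `vaughan_meanValue` (a `def … : Prop`, not asserted).
* Auxiliary quantities of the classical reduction (last section): `psiPrime`, `nonCoprimePart`,
  `totientInvSum`, `SWBound`, `primIndex`, `induce`, `psiSubSelfSup`, `majorant`, `primTerm`,
  `vaughanTerm`, `VaughanBound`, each with its trivial API (nonnegativity, reindexing,
  `vaughanBound_of_vaughan_meanValue`); the proofs using them live in
  `BombieriVinogradovReduction.lean`.

## References

* R. C. Vaughan, *An elementary method in prime number theory*, Acta Arith. 37 (1980), 111–115,
  Theorem 1. [Vaughan1980]
* E. Bombieri, *On the large sieve*, Mathematika 12 (1965), 201–225, Theorem 4. [Bombieri1965]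
* O. Bordellès, *Arithmetic Tales* (Springer, 2012), Theorem 4.51.
* A. C. Cojocaru, M. R. Murty, *An Introduction to Sieve Methods and their Applications*
  (CUP, 2005), Theorem 9.2.2 and §9.2.
-/

open Finset Real
open scoped ArithmeticFunction.vonMangoldt

namespace Literature.NumberTheory.Sieve

/-! ### The twisted Chebyshev function `ψ(x, χ)` -/

/-- `ψ(x, χ) = ∑_{n ≤ x} χ(n) Λ(n)`, the Chebyshev function twisted by a Dirichlet character
`χ mod q` (Davenport, *Multiplicative Number Theory*, §19; Vaughan, Acta Arith. 37 (1980), (2)).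
The sum runs over `0 ≤ n ≤ ⌊x⌋₊` like `Literature.NumberTheory.Sieve.ParityWave0.chebyshevPsiMod`; the `n = 0` term vanishes.
[cite: Vaughan1980, (2)] -/
noncomputable def chebyshevPsiChar {q : ℕ} (χ : DirichletCharacter ℂ q) (x : ℝ) : ℂ :=
  ∑ n ∈ range (⌊x⌋₊ + 1), χ n * Λ n

/-- `max_{y ≤ Y} |ψ(y, χ)|`, the quantity averaged in Vaughan's mean value theorem
(Vaughan, Acta Arith. 37 (1980), (1)). Since `ψ(y, χ) = ψ(⌊y⌋₊, χ)` and `ψ(y, χ) = 0` for `y < 1`,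
the maximum over real `y ≤ Y` equals the maximum of `‖ψ(N, χ)‖` over the integers
`0 ≤ N ≤ ⌊Y⌋₊`, taken here as a `Finset.sup'` (no junk value: the range is nonempty).
[cite: Vaughan1980, (1)] -/
noncomputable def chebyshevPsiCharSup {q : ℕ} (χ : DirichletCharacter ℂ q) (Y : ℝ) : ℝ :=
  (range (⌊Y⌋₊ + 1)).sup' ⟨0, by simp⟩ fun N : ℕ => ‖chebyshevPsiChar χ N‖

/-- `ψ(x, χ)` only depends on the integer part of `x`. [folklore] -/
theorem chebyshevPsiChar_eq_floor {q : ℕ} (χ : DirichletCharacter ℂ q) (x : ℝ) :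
    chebyshevPsiChar χ x = chebyshevPsiChar χ (⌊x⌋₊ : ℕ) := by
  simp [chebyshevPsiChar, Nat.floor_natCast]

/-- The trivial bound `|ψ(x, χ)| ≤ ψ(x)` (Mathlib's `Chebyshev.psi`), from `|χ(n)| ≤ 1` and
`Λ ≥ 0`. [folklore] -/
theorem norm_chebyshevPsiChar_le_psi {q : ℕ} (χ : DirichletCharacter ℂ q) (x : ℝ) :
    ‖chebyshevPsiChar χ x‖ ≤ Chebyshev.psi x := by
  rw [chebyshevPsiChar, Chebyshev.psi, Finset.range_eq_Ico,
    Finset.sum_eq_sum_Ico_succ_bot (by omega : 0 < ⌊x⌋₊ + 1), Finset.Ico_add_one_add_one_eq_Ioc]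
  simp only [Nat.cast_zero, ArithmeticFunction.map_zero, Complex.ofReal_zero, mul_zero, zero_add]
  refine (norm_sum_le _ _).trans (Finset.sum_le_sum fun n _ => ?_)
  rw [norm_mul, Complex.norm_real, Real.norm_of_nonneg ArithmeticFunction.vonMangoldt_nonneg]
  exact mul_le_of_le_one_left ArithmeticFunction.vonMangoldt_nonneg (χ.norm_le_one _)

/-- `max_{y ≤ Y} |ψ(y, χ)| ≥ 0`. [folklore] -/
theorem chebyshevPsiCharSup_nonneg {q : ℕ} (χ : DirichletCharacter ℂ q) (Y : ℝ) :
    0 ≤ chebyshevPsiCharSup χ Y :=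
  (norm_nonneg (chebyshevPsiChar χ ((0 : ℕ) : ℝ))).trans
    (Finset.le_sup' (fun N : ℕ => ‖chebyshevPsiChar χ N‖) (by simp))

/-- `|ψ(y, χ)| ≤ max_{y' ≤ Y} |ψ(y', χ)|` for `y ≤ Y` (for `y < 0` the left side is `ψ(0, χ) = 0`).
[folklore] -/
theorem norm_chebyshevPsiChar_le_sup {q : ℕ} (χ : DirichletCharacter ℂ q) {y Y : ℝ}
    (hy : y ≤ Y) : ‖chebyshevPsiChar χ y‖ ≤ chebyshevPsiCharSup χ Y := by
  rw [chebyshevPsiChar_eq_floor]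
  refine Finset.le_sup' (fun N : ℕ => ‖chebyshevPsiChar χ N‖) ?_
  exact mem_range.2 (Nat.lt_succ_of_le (Nat.floor_le_floor hy))

/-- `max_{y ≤ Y} |ψ(y, χ)| ≤ B` as soon as `|ψ(N, χ)| ≤ B` for every integer `0 ≤ N ≤ Y`.
[folklore] -/
theorem chebyshevPsiCharSup_le {q : ℕ} (χ : DirichletCharacter ℂ q) {Y B : ℝ}
    (h : ∀ N : ℕ, (N : ℝ) ≤ Y → ‖chebyshevPsiChar χ N‖ ≤ B) (hY : 0 ≤ Y) :
    chebyshevPsiCharSup χ Y ≤ B := by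
  refine Finset.sup'_le _ _ fun N hN => h N ?_
  exact (Nat.cast_le.2 (Nat.lt_succ_iff.1 (mem_range.1 hN))).trans (Nat.floor_le hY)

/-- `max_{y ≤ Y} |ψ(y, χ)| ≤ ψ(Y)` for `Y ≥ 0`. [folklore] -/
theorem chebyshevPsiCharSup_le_psi {q : ℕ} (χ : DirichletCharacter ℂ q) {Y : ℝ} (hY : 0 ≤ Y) :
    chebyshevPsiCharSup χ Y ≤ Chebyshev.psi Y :=
  chebyshevPsiCharSup_le χ
    (fun N hN => (norm_chebyshevPsiChar_le_psi χ N).trans (Chebyshev.psi_mono hN)) hY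

/-! ### Vaughan's basic mean value theorem (named fact) -/

open scoped Classical in
/-- **Vaughan's mean value theorem** (Vaughan, *An elementary method in prime number theory*,
Acta Arith. 37 (1980), 111–115, Theorem 1; Davenport, *Multiplicative Number Theory*, ch. 28,
(2); Bordellès, *Arithmetic Tales*, Thm 4.51). Let `Q ≥ 1`, `Y ≥ 2`, `ℒ = log(YQ)`. Then
`T(Y, Q) := ∑_{q ≤ Q} (q/φ(q)) ∑*_{χ mod q} max_{y ≤ Y} |ψ(y, χ)| ≪ (Y + Y^{5/6} Q + Y^{1/2} Q²) ℒ⁴`,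
where `∑*` runs over the primitive characters modulo `q` and the implied constant is absolute.
Stated for integer `Q` (the printed statement allows real `Q ≥ 1`; the sum only sees `⌊Q⌋`).
This is the large-sieve input of the Bombieri–Vinogradov theorem; its own proof (Vaughan's
identity, the multiplicative large sieve `Literature.NumberTheory.Sieve.large_sieve_inequality` via Gauss sums,
Pólya–Vinogradov) is not formalised here. [cite: Vaughan1980, Theorem 1] -/
def vaughan_meanValue : Prop :=
  ∃ C : ℝ, ∀ (Q : ℕ), 1 ≤ Q → ∀ (Y : ℝ), 2 ≤ Y →
    ∑ q ∈ Icc 1 Q, (q : ℝ) / (Nat.totient q) *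
        ∑ χ : DirichletCharacter ℂ q with χ.IsPrimitive, chebyshevPsiCharSup χ Y ≤
      C * (Y + Y ^ (5 / 6 : ℝ) * Q + Y ^ (1 / 2 : ℝ) * (Q : ℝ) ^ 2) * Real.log (Y * Q) ^ 4

/-! ### Auxiliary quantities of the classical reduction

The elementary deduction `vaughan_meanValue → siegel_walfisz → bombieri_vinogradov`
(Davenport, ch. 28; Cojocaru–Murty, §9.2) is carried out in
`Literature/NumberTheory/Sieve/BombieriVinogradovReduction.lean`, which consists of proofs
only; the quantities it manipulates are defined here, each with its trivial API:
`ψ'(y, χ) = ψ(y, χ) − [χ = χ₀] y` (`psiPrime`), `R(q, y) = ∑_{n ≤ y, (n,q) > 1} Λ(n)`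
(`nonCoprimePart`), `W(Q) = ∑_{m ≤ Q} 1/φ(m)` (`totientInvSum`), the index set
`S(q) = {(d, χ₁) : d ∣ q, χ₁ primitive mod d}` with the induced character (`primIndex`,
`induce`), the majorants `P(x) = 1 + max_{N ≤ x} |ψ(N) − N|` (`psiSubSelfSup`) and
`M(x; d, χ₁)` (`majorant`), the swapped-sum terms `Φ(x; d)` (`primTerm`) and
`a(x; d) = (d/φ(d)) ∑*_{χ mod d} max_{y ≤ x} |ψ(y, χ)|` (`vaughanTerm`, the summand of
Vaughan's `T(x, Q)`), and the two constant packages `SWBound A₂ C₂` (the shape of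
`siegel_walfisz`) and `VaughanBound C₁` (the shape of `vaughan_meanValue`, see
`vaughanBound_of_vaughan_meanValue`). -/

open scoped Classical in
/-- `ψ'(y, χ) = ψ(y, χ) − [χ = χ₀] y` (Davenport, *Multiplicative Number Theory*, ch. 28).
[folklore] -/
noncomputable def psiPrime {q : ℕ} (χ : DirichletCharacter ℂ q) (y : ℝ) : ℂ :=
  chebyshevPsiChar χ y - if χ = 1 then (y : ℂ) else 0

/-- `ψ'(y, χ₀) = ψ(y, χ₀) − y`. [folklore] -/
theorem psiPrime_one (q : ℕ) (y : ℝ) :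
    psiPrime (1 : DirichletCharacter ℂ q) y =
      chebyshevPsiChar (1 : DirichletCharacter ℂ q) y - y := by
  simp [psiPrime]

/-- `ψ'(y, χ) = ψ(y, χ)` for `χ ≠ χ₀`. [folklore] -/
theorem psiPrime_of_ne_one {q : ℕ} {χ : DirichletCharacter ℂ q} (hχ : χ ≠ 1) (y : ℝ) :
    psiPrime χ y = chebyshevPsiChar χ y := by
  simp [psiPrime, hχ]

/-- `R(q, y) = ∑_{n ≤ y, (n, q) > 1} Λ(n)`, the cost of replacing `χ mod q` by the character
inducing it. [folklore] -/
noncomputable def nonCoprimePart (q : ℕ) (y : ℝ) : ℝ :=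
  ∑ n ∈ range (⌊y⌋₊ + 1) with ¬ n.Coprime q, Λ n

/-- `R(q, y) ≥ 0`. [folklore] -/
theorem nonCoprimePart_nonneg (q : ℕ) (y : ℝ) : 0 ≤ nonCoprimePart q y :=
  Finset.sum_nonneg fun _ _ => ArithmeticFunction.vonMangoldt_nonneg

/-- `R(q, y)` is monotone in `y`. [folklore] -/
theorem nonCoprimePart_mono (q : ℕ) {y x : ℝ} (h : y ≤ x) :
    nonCoprimePart q y ≤ nonCoprimePart q x := by
  refine Finset.sum_le_sum_of_subset_of_nonneg ?_ fun _ _ _ => ArithmeticFunction.vonMangoldt_nonneg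
  exact Finset.filter_subset_filter _
    (Finset.range_mono (Nat.succ_le_succ (Nat.floor_le_floor h)))

/-- `W(Q) = ∑_{m ≤ Q} 1/φ(m)`. [folklore] -/
noncomputable def totientInvSum (Q : ℕ) : ℝ := ∑ m ∈ Icc 1 Q, ((Nat.totient m : ℝ))⁻¹

/-- `W(Q) ≥ 0`. [folklore] -/
theorem totientInvSum_nonneg (Q : ℕ) : 0 ≤ totientInvSum Q :=
  Finset.sum_nonneg fun _ _ => inv_nonneg.2 (Nat.cast_nonneg _)

/-- The shape of the Siegel–Walfisz constant package used below. [folklore] -/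
def SWBound (A₂ C₂ : ℝ) : Prop :=
  ∀ x : ℝ, 2 ≤ x → ∀ q : ℕ, 1 ≤ q → (q : ℝ) ≤ Real.log x ^ A₂ →
    ∀ a : (ZMod q)ˣ, |ParityWave0.chebyshevPsiMod q a x - x / Nat.totient q| ≤ C₂ * x / Real.log x ^ A₂

section Auxiliary
open scoped Classical

/-- The index set `S(q) = {(d, χ₁) : d ∣ q, χ₁ primitive mod d}`. [folklore] -/
noncomputable def primIndex (q : ℕ) : Finset (Σ d : ℕ, DirichletCharacter ℂ d) :=
  (Nat.divisors q).sigma fun d => (univ : Finset (DirichletCharacter ℂ d)).filter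
    DirichletCharacter.IsPrimitive

/-- The character mod `q` induced by `(d, χ₁)` (junk `1` if `d ∤ q`). [folklore] -/
noncomputable def induce (q : ℕ) (σ : Σ d : ℕ, DirichletCharacter ℂ d) : DirichletCharacter ℂ q :=
  if h : σ.1 ∣ q then DirichletCharacter.changeLevel h σ.2 else 1

/-- Membership in the index set `S(q)`. [folklore] -/
theorem mem_primIndex {q : ℕ} {σ : Σ d : ℕ, DirichletCharacter ℂ d} :
    σ ∈ primIndex q ↔ σ.1 ∣ q ∧ q ≠ 0 ∧ σ.2.IsPrimitive := by
  simp [primIndex, Nat.mem_divisors, and_assoc]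

/-- Every character mod `q ≥ 1` is induced by a primitive character to a modulus dividing `q`
(its conductor): `induce q` maps `S(q)` onto the characters mod `q`. [folklore] -/
theorem image_induce_primIndex (q : ℕ) [NeZero q] :
    (primIndex q).image (induce q) = univ := by
  refine Finset.eq_univ_of_forall fun χ => Finset.mem_image.2 ?_
  refine ⟨⟨χ.conductor, χ.primitiveCharacter⟩, ?_, ?_⟩
  · exact mem_primIndex.2 ⟨χ.conductor_dvd_level, NeZero.ne q, χ.primitiveCharacter_isPrimitive⟩
  · rw [induce, dif_pos χ.conductor_dvd_level]
    exact χ.changeLevel_primitiveCharacter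

/-- Reindexing: a nonnegative sum over all characters mod `q` is at most the same sum indexed by
`S(q)` through `induce`. [folklore] -/
theorem sum_le_sum_primIndex (q : ℕ) [NeZero q] {f : DirichletCharacter ℂ q → ℝ}
    (hf : ∀ χ, 0 ≤ f χ) : ∑ χ, f χ ≤ ∑ σ ∈ primIndex q, f (induce q σ) := by
  rw [← image_induce_primIndex q]
  exact Finset.sum_image_le_of_nonneg fun χ _ => hf χ

/-- `#S(q) ≤ ∑_{d ∣ q} φ(d) = q`. [folklore] -/
theorem card_primIndex_le (q : ℕ) : (primIndex q).card ≤ q := by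
  rw [primIndex, Finset.card_sigma]
  calc ∑ d ∈ q.divisors, #((univ : Finset (DirichletCharacter ℂ d)).filter
          DirichletCharacter.IsPrimitive)
      ≤ ∑ d ∈ q.divisors, Nat.totient d := Finset.sum_le_sum fun d hd => by
        haveI : NeZero d := ⟨Nat.pos_of_mem_divisors hd |>.ne'⟩
        refine (Finset.card_filter_le _ _).trans ?_
        rw [Finset.card_univ, ← Nat.card_eq_fintype_card,
          DirichletCharacter.card_eq_totient_of_hasEnoughRootsOfUnity ℂ d]
    _ = q := Nat.sum_totient q

/-- `P(x) = 1 + max_{N ≤ x} |ψ(N) − N|`, a bound for `|ψ(y) − y|`, `0 ≤ y ≤ x`. [folklore] -/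
noncomputable def psiSubSelfSup (x : ℝ) : ℝ :=
  1 + (range (⌊x⌋₊ + 1)).sup' ⟨0, by simp⟩ fun N : ℕ => |Chebyshev.psi N - N|

/-- `|ψ(y) − y| ≤ P(x)` for `0 ≤ y ≤ x` (pass to `⌊y⌋` at cost `≤ 1`). [folklore] -/
theorem abs_psi_sub_self_le_psiSubSelfSup {y x : ℝ} (hy : 0 ≤ y) (hyx : y ≤ x) :
    |Chebyshev.psi y - y| ≤ psiSubSelfSup x := by
  have h1 : |Chebyshev.psi y - y| ≤ |Chebyshev.psi (⌊y⌋₊ : ℕ) - ⌊y⌋₊| + 1 := by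
    rw [Chebyshev.psi_eq_psi_coe_floor y]
    have h2 : (⌊y⌋₊ : ℝ) ≤ y := Nat.floor_le hy
    have h3 : y < ⌊y⌋₊ + 1 := Nat.lt_floor_add_one y
    calc |Chebyshev.psi (⌊y⌋₊ : ℕ) - y|
        = |(Chebyshev.psi (⌊y⌋₊ : ℕ) - ⌊y⌋₊) + ((⌊y⌋₊ : ℝ) - y)| := by ring_nf
      _ ≤ |Chebyshev.psi (⌊y⌋₊ : ℕ) - ⌊y⌋₊| + |(⌊y⌋₊ : ℝ) - y| := abs_add_le _ _
      _ ≤ _ := by gcongr; rw [abs_le]; constructor <;> linarith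
  rw [psiSubSelfSup, add_comm (1 : ℝ)]
  refine h1.trans ?_
  gcongr
  refine Finset.le_sup' (fun N : ℕ => |Chebyshev.psi N - N|) ?_
  exact mem_range.2 (Nat.lt_succ_of_le (Nat.floor_le_floor hyx))

/-- The `y`-uniform majorant `M(x; d, χ₁)`. [folklore] -/
noncomputable def majorant (x : ℝ) (σ : Σ d : ℕ, DirichletCharacter ℂ d) : ℝ :=
  if σ.1 = 1 then psiSubSelfSup x else chebyshevPsiCharSup σ.2 x

/-- `M(x; d, χ₁) ≥ 0`. [folklore] -/
theorem majorant_nonneg (x : ℝ) (σ : Σ d : ℕ, DirichletCharacter ℂ d) : 0 ≤ majorant x σ := by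
  rw [majorant]
  split_ifs
  · rw [psiSubSelfSup]
    exact add_nonneg zero_le_one ((abs_nonneg _).trans
      (Finset.le_sup' (fun N : ℕ => |Chebyshev.psi N - N|) (by simp : 0 ∈ range (⌊x⌋₊ + 1))))
  · exact chebyshevPsiCharSup_nonneg _ _

/-- `P(x) ≥ 0`. [folklore] -/
theorem psiSubSelfSup_nonneg (x : ℝ) : 0 ≤ psiSubSelfSup x := by
  have := majorant_nonneg x ⟨1, 1⟩
  simpa [majorant] using this

/-- `Φ(x; d) = (1/φ(d)) ∑_{χ₁ primitive mod d} M(x; d, χ₁)`, the `d`-th term after swapping the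
`q`- and `d`-sums. [folklore] -/
noncomputable def primTerm (x : ℝ) (d : ℕ) : ℝ :=
  ((Nat.totient d : ℝ))⁻¹ * ∑ χ ∈ (univ : Finset (DirichletCharacter ℂ d)).filter
    DirichletCharacter.IsPrimitive, majorant x ⟨d, χ⟩

/-- `Φ(x; d) ≥ 0`. [folklore] -/
theorem primTerm_nonneg (x : ℝ) (d : ℕ) : 0 ≤ primTerm x d :=
  mul_nonneg (inv_nonneg.2 (Nat.cast_nonneg _)) (Finset.sum_nonneg fun _ _ => majorant_nonneg x _)

/-- `a(x; d) = (d/φ(d)) ∑*_{χ mod d} max_{y ≤ x} |ψ(y, χ)|`, the summand of Vaughan's `T(x, Q)`.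
[folklore] -/
noncomputable def vaughanTerm (x : ℝ) (d : ℕ) : ℝ :=
  (d : ℝ) / Nat.totient d * ∑ χ ∈ (univ : Finset (DirichletCharacter ℂ d)).filter
    DirichletCharacter.IsPrimitive, chebyshevPsiCharSup χ x

/-- `a(x; d) ≥ 0`. [folklore] -/
theorem vaughanTerm_nonneg (x : ℝ) (d : ℕ) : 0 ≤ vaughanTerm x d :=
  mul_nonneg (by positivity) (Finset.sum_nonneg fun χ _ => chebyshevPsiCharSup_nonneg χ x)

/-- For `d ≥ 2` (no principal primitive character): `Φ(x; d) = a(x; d)/d`. [folklore] -/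
theorem primTerm_eq_vaughanTerm_div (x : ℝ) {d : ℕ} (hd : 2 ≤ d) :
    primTerm x d = vaughanTerm x d / d := by
  have hd0 : (d : ℝ) ≠ 0 := by positivity
  have h1 : ∀ χ ∈ (univ : Finset (DirichletCharacter ℂ d)).filter DirichletCharacter.IsPrimitive,
      majorant x ⟨d, χ⟩ = chebyshevPsiCharSup χ x := fun χ _ => by
    rw [majorant, if_neg (show ¬ d = 1 by omega)]
  rw [primTerm, Finset.sum_congr rfl h1, vaughanTerm]
  field_simp

/-- The shape of Vaughan's mean value theorem with an explicit constant. [folklore] -/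
def VaughanBound (C₁ : ℝ) : Prop :=
  ∀ Q : ℕ, 1 ≤ Q → ∀ Y : ℝ, 2 ≤ Y →
    ∑ q ∈ Icc 1 Q, vaughanTerm Y q ≤
      C₁ * (Y + Y ^ (5 / 6 : ℝ) * Q + Y ^ (1 / 2 : ℝ) * (Q : ℝ) ^ 2) * Real.log (Y * Q) ^ 4

/-- `vaughan_meanValue` in the packaged form `VaughanBound C₁` with `C₁ ≥ 0`. [folklore] -/
theorem vaughanBound_of_vaughan_meanValue (hV : vaughan_meanValue) :
    ∃ C₁, 0 ≤ C₁ ∧ VaughanBound C₁ := by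
  obtain ⟨C, hC⟩ := hV
  refine ⟨max C 0, le_max_right _ _, fun Q hQ Y hY2 => ?_⟩
  have hY : 0 < Y := by linarith
  calc ∑ q ∈ Icc 1 Q, vaughanTerm Y q
      ≤ C * (Y + Y ^ (5 / 6 : ℝ) * Q + Y ^ (1 / 2 : ℝ) * (Q : ℝ) ^ 2) * Real.log (Y * Q) ^ 4 :=
        hC Q hQ Y hY2
    _ ≤ _ := by gcongr; exact le_max_left _ _

end Auxiliary

end Literature.NumberTheory.Sieve
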